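import Mathlib
import Summits.CriticalPhenomena.PercolationContinuityZ3.Theorems.PercNearOneGluingNoHeavyLowerTailFallingMesh
import Summits.CriticalPhenomena.PercolationContinuityZ3.Theorems.PercNearOneGluingNoHeavyLowerTailDiffHurwitzChain
import Summits.CriticalPhenomena.PercolationContinuityZ3.Theorems.PercNearOneGluingNoHeavyLowerTailDiffHurwitzRouthChain
import HarnessLib

/-!
# The Hurwitz matrix of a positive pair is totally nonnegative (classical Asner–Kemperman theorem, by Routh chains)

Support file for the Sahi / Conjecture-P programme of route `PercNearOneGluingNoHeavy`
(`--supports stmt-CriticalPhenomena-4575`, prover prim-l12-p5 gen 48; proof note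
`prim-l12-p5/PROOF-DIFFERENCE-HURWITZ-g48.md` §2 (the `g → 0` member of the discrete Routh algorithm) and
`PROOF-NEUTRAL-HURWITZ-g47.md` §2.3, where this classical fact is the missing ingredient of the Lean port of
THEOREM R^neut).  No definitions, no named facts, no sorries.

A POSITIVE PAIR is `p = lp·∏_{i≤k}(X - α_i)`, `q = lq·∏_{i<k}(X - γ_i)` with `lp, lq > 0` and negative, strictly
interlacing zeros `α_0 < γ_0 < α_1 < γ_1 < … < γ_{k-1} < α_k < 0`.  `DiffHurwitz.classicalRouthChain_exists`: the
classical Routh algorithm `p₁ = p - (lp/lq)·X·q`, `q₂ = q - (lq/lp₁)·p₁` runs `k+1` rounds with positive constants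
down to `(κ, 0)`, `κ > 0`, and positive pairs stay positive pairs (sign counting + IVT + Lagrange uniqueness, the
tools of `…FallingMesh`).  `DiffHurwitz.positivePair_hurwitz_tn`: consequently the (generalized) Hurwitz matrix
`H(2n, l) = [X^{n-l}] p`, `H(2n+1, l) = [X^{n-l}] q` of a positive pair is totally nonnegative — via
`DiffHurwitz.chain_tn` applied to the diagonally rescaled rows `n^{(n-l)}·[X^{n-l}]f` (the rows of `f(D)`).
With Hermite–Biehler this is the total nonnegativity of the Hurwitz matrix of a Hurwitz-stable polynomial
`p(z²) + z q(z²)` [Asner 1970; Kemperman 1982; Holtz–Tyaglov, SIAM Rev. 54 (2012) §3].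
-/

namespace Summit.CriticalPhenomena.PercolationContinuityZ3.Theorems

namespace DiffHurwitz

open Finset Polynomial FallingMesh

/-- **Classical Routh chain of a positive pair.** -/
theorem classicalRouthChain_exists : ∀ (k : ℕ) (lp lq : ℝ) (α γ : ℕ → ℝ), 0 < lp → 0 < lq → α k < 0 →
    (∀ i, i < k → α i < γ i ∧ γ i < α (i + 1)) →
    ∃ (P Q : ℕ → ℝ[X]) (cs cs' : ℕ → ℝ) (κ : ℝ), 0 < κ ∧ (∀ j, 0 ≤ cs j) ∧ (∀ j, 0 ≤ cs' j) ∧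
      P 0 = C lp * ∏ i ∈ range (k + 1), (X - C (α i)) ∧ Q 0 = C lq * ∏ i ∈ range k, (X - C (γ i)) ∧
      (∀ j, j < k + 1 → P j = P (j + 1) + C (cs j) * X * Q j) ∧
      (∀ j, j < k + 1 → Q j = Q (j + 1) + C (cs' j) * P (j + 1)) ∧
      P (k + 1) = C κ ∧ Q (k + 1) = 0 := by
  intro k
  induction k with
  | zero =>
    intro lp lq α γ hlp hlq hα _
    have hκ : 0 < -lp * α 0 := by nlinarith
    refine ⟨fun j => if j = 0 then C lp * ∏ i ∈ range 1, (X - C (α i)) else C (-lp * α 0),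
      fun j => if j = 0 then C lq else 0, fun _ => lp / lq, fun _ => lq / (-lp * α 0), -lp * α 0,
      hκ, fun _ => (div_pos hlp hlq).le, fun _ => (div_pos hlq hκ).le, by simp, by simp,
      fun j hj => ?_, fun j hj => ?_, by simp, by simp⟩
    · rw [show j = 0 by omega]; dsimp only; rw [if_pos rfl, if_pos rfl, if_neg (Nat.succ_ne_zero 0)]
      have hlq0 : lq ≠ 0 := ne_of_gt hlq
      have e1 : C (lp / lq) * X * C lq = (C lp * X : ℝ[X]) := by
        rw [mul_comm (C (lp / lq)) X, mul_assoc, ← C_mul, show lp / lq * lq = lp by field_simp, mul_comm]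
      rw [prod_range_one, e1, show -lp * α 0 = -(lp * α 0) by ring, C_neg, C_mul]; ring
    · rw [show j = 0 by omega]; dsimp only
      have hα0 : α 0 ≠ 0 := ne_of_lt hα
      have hlp0 : lp ≠ 0 := ne_of_gt hlp
      rw [if_pos rfl, if_neg (Nat.succ_ne_zero 0), if_neg (Nat.succ_ne_zero 0), zero_add, ← C_mul,
        show lq / (-lp * α 0) * (-lp * α 0) = lq by field_simp]
  | succ k ih =>
    intro lp lq α γ hlp hlq hαneg hJ
    have hαmono : ∀ i j, i < j → j ≤ k + 1 → α i < α j := by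
      intro i j hij hjk
      induction j with
      | zero => exact absurd hij (by omega)
      | succ j ihj =>
        have hJj := hJ j (by omega)
        rcases Nat.lt_or_ge i j with h' | h'
        · have := ihj h' (by omega); linarith [hJj.1, hJj.2]
        · rw [show i = j by omega]; linarith [hJj.1, hJj.2]
    have hαle : ∀ i j, i ≤ j → j ≤ k + 1 → α i ≤ α j := by
      intro i j hij hjk
      rcases Nat.lt_or_ge i j with h' | h'
      · exact (hαmono i j h' hjk).le
      · rw [show i = j by omega]
    have hγle : ∀ i j, i ≤ j → j < k + 1 → γ i ≤ γ j := by
      intro i j hij hjk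
      rcases Nat.lt_or_ge i j with h' | h'
      · linarith [(hJ i (by omega)).2, (hJ j hjk).1, hαle (i + 1) j (by omega) (by omega)]
      · rw [show i = j by omega]
    have hαneg' : ∀ i, i ≤ k + 1 → α i < 0 := fun i hi => lt_of_le_of_lt (hαle i (k + 1) hi le_rfl) hαneg
    obtain ⟨p, hp⟩ : ∃ p : ℝ[X], p = C lp * ∏ i ∈ range (k + 1 + 1), (X - C (α i)) := ⟨_, rfl⟩
    obtain ⟨qt, hqt⟩ : ∃ qt : ℝ[X], qt = C lq * ∏ i ∈ range (k + 1), (X - C (γ i)) := ⟨_, rfl⟩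
    ------------------------------------------------------------------ STEP A
    obtain ⟨c, hc⟩ : ∃ c : ℝ, c = lp / lq := ⟨_, rfl⟩
    have hcpos : 0 < c := by rw [hc]; exact div_pos hlp hlq
    have hclq : c * lq = lp := by rw [hc]; field_simp
    obtain ⟨p₁, hp₁⟩ : ∃ p₁ : ℝ[X], p₁ = p - C c * X * qt := ⟨_, rfl⟩
    have hev₁ : ∀ y, p₁.eval y = lp * ∏ i ∈ range (k + 1 + 1), (y - α i)
        - c * y * (lq * ∏ i ∈ range (k + 1), (y - γ i)) := by
      intro y; rw [hp₁, eval_sub, hp, prodForm_eval, eval_mul, eval_mul, eval_C, eval_X, hqt, prodForm_eval]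
    have hsA1 : ∀ j, j < k + 1 → 0 < (-1 : ℝ) ^ (k + 1 - j) * p₁.eval (γ j) := by
      intro j hj
      have hz : ∏ i ∈ range (k + 1), (γ j - γ i) = 0 := prod_eq_zero (mem_range.2 hj) (sub_self _)
      have hs := sign_prod (k + 1 + 1) (k + 1 - j) α (γ j) (by omega)
        (fun i hi => by linarith [hαle i j (by omega) (by omega), (hJ j hj).1])
        (fun i hi hi' => by linarith [hαle (j + 1) i (by omega) (by omega), (hJ j hj).2])
      rw [hev₁, hz]; simp only [mul_zero, sub_zero]
      rw [show (-1 : ℝ) ^ (k + 1 - j) * (lp * ∏ i ∈ range (k + 1 + 1), (γ j - α i))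
        = lp * ((-1 : ℝ) ^ (k + 1 - j) * ∏ i ∈ range (k + 1 + 1), (γ j - α i)) by ring]
      exact mul_pos hlp hs
    have hsA2 : ∀ j, j < k + 1 + 1 → 0 < (-1 : ℝ) ^ (k + 1 - j) * p₁.eval (α j) := by
      intro j hj
      have hz : ∏ i ∈ range (k + 1 + 1), (α j - α i) = 0 := prod_eq_zero (mem_range.2 hj) (sub_self _)
      have hs := sign_prod (k + 1) (k + 1 - j) γ (α j) (by omega)
        (fun i hi => by linarith [(hJ i (by omega)).2, hαle (i + 1) j (by omega) (by omega)])
        (fun i hi hi' => by linarith [(hJ i hi').1, hαle j i (by omega) (by omega)])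
      rw [hev₁, hz, mul_zero, zero_sub]
      have hαj := hαneg' j (by omega)
      rw [show (-1 : ℝ) ^ (k + 1 - j) * -(c * α j * (lq * ∏ i ∈ range (k + 1), (α j - γ i)))
        = (c * (-α j) * lq) * ((-1 : ℝ) ^ (k + 1 - j) * ∏ i ∈ range (k + 1), (α j - γ i)) by ring]
      exact mul_pos (mul_pos (mul_pos hcpos (by linarith)) hlq) hs
    have hexA : ∀ j, j < k + 1 → ∃ x, γ j < x ∧ x < α (j + 1) ∧ p₁.eval x = 0 := by
      intro j hj
      apply exists_root_of_sign_change _ p₁.continuous _ _ (hJ j hj).2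
      have h1 := hsA1 j hj
      have h2 := hsA2 (j + 1) (by omega)
      rw [show (-1 : ℝ) ^ (k + 1 - j) = (-1) ^ (k + 1 - (j + 1)) * (-1) by
        rw [← pow_succ, show k + 1 - (j + 1) + 1 = k + 1 - j by omega]] at h1
      exact mul_neg_of_signs _ _ _ h1 h2
    choose! α' hα' using hexA
    have hα'1 : ∀ j, j < k + 1 → γ j < α' j := fun j hj => (hα' j hj).1
    have hα'2 : ∀ j, j < k + 1 → α' j < α (j + 1) := fun j hj => (hα' j hj).2.1
    have hα'3 : ∀ j, j < k + 1 → p₁.eval (α' j) = 0 := fun j hj => (hα' j hj).2.2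
    have hα'mono : ∀ i j, i < j → j < k + 1 → α' i < α' j := by
      intro i j hij hjk
      linarith [hα'2 i (by omega), hα'1 j hjk, (hJ j hjk).1, hαle (i + 1) j (by omega) (by omega)]
    have hα'le : ∀ i j, i ≤ j → j < k + 1 → α' i ≤ α' j := by
      intro i j hij hjk
      rcases Nat.lt_or_ge i j with h' | h'
      · exact (hα'mono i j h' hjk).le
      · rw [show i = j by omega]
    have hα'top : ∀ j, j < k + 1 → α' j < α (k + 1) :=
      fun j hj => lt_of_lt_of_le (hα'2 j hj) (hαle (j + 1) (k + 1) (by omega) le_rfl)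
    obtain ⟨hpnd, hplc⟩ := prodForm_natDegree lp (ne_of_gt hlp) α (k + 1 + 1)
    rw [← hp] at hpnd hplc
    obtain ⟨G₁, hG₁⟩ : ∃ G₁ : ℝ[X], G₁ = C c * X * qt := ⟨_, rfl⟩
    have hδ : ∀ i ∈ range (k + 1), (X - C (if i < k + 1 then γ i else 0) : ℝ[X]) = X - C (γ i) :=
      fun i hi => by rw [if_pos (mem_range.1 hi)]
    have hG₁form : G₁ = C (c * lq) * ∏ i ∈ range (k + 1 + 1), (X - C (if i < k + 1 then γ i else 0)) := by
      rw [hG₁, hqt, prod_range_succ _ (k + 1), if_neg (lt_irrefl _), C_0, sub_zero, C_mul, prod_congr rfl hδ]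
      ring
    obtain ⟨hG₁nd, hG₁lc⟩ := prodForm_natDegree (c * lq) (ne_of_gt (mul_pos hcpos hlq))
      (fun i => if i < k + 1 then γ i else 0) (k + 1 + 1)
    rw [← hG₁form] at hG₁nd hG₁lc
    have hp₁deg : p₁.degree ≤ (k + 1 : ℕ) := by
      rw [hp₁, ← hG₁]
      exact degree_sub_le_of_cancel p G₁ (k + 1) hpnd hG₁nd (by rw [hplc, hG₁lc, hclq])
    have hp₁form := eq_prod_of_roots (k + 1) p₁ hp₁deg α' hα'mono hα'3 (α (k + 1)) hα'top
    obtain ⟨lp₁, hlp₁⟩ : ∃ lp₁ : ℝ, lp₁ = p₁.eval (α (k + 1)) / ∏ j ∈ range (k + 1), (α (k + 1) - α' j) :=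
      ⟨_, rfl⟩
    rw [← hlp₁] at hp₁form
    have hlp₁pos : 0 < lp₁ := by
      rw [hlp₁]
      refine div_pos ?_ (prod_pos fun j hj => by rw [mem_range] at hj; linarith [hα'top j hj])
      have := hsA2 (k + 1) (by omega); rwa [Nat.sub_self, pow_zero, one_mul] at this
    have hev₁' : ∀ y, p₁.eval y = lp₁ * ∏ j ∈ range (k + 1), (y - α' j) := by
      intro y; rw [hp₁form, prodForm_eval]
    ------------------------------------------------------------------ STEP B
    obtain ⟨c', hc'⟩ : ∃ c' : ℝ, c' = lq / lp₁ := ⟨_, rfl⟩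
    have hc'pos : 0 < c' := by rw [hc']; exact div_pos hlq hlp₁pos
    have hc'lp : c' * lp₁ = lq := by rw [hc']; field_simp
    obtain ⟨q₂, hq₂⟩ : ∃ q₂ : ℝ[X], q₂ = qt - C c' * p₁ := ⟨_, rfl⟩
    have hev₂ : ∀ y, q₂.eval y = lq * ∏ i ∈ range (k + 1), (y - γ i)
        - c' * (lp₁ * ∏ j ∈ range (k + 1), (y - α' j)) := by
      intro y; rw [hq₂, eval_sub, hqt, prodForm_eval, eval_mul, eval_C, hev₁']
    have hsB1 : ∀ j, j < k + 1 → 0 < (-1 : ℝ) ^ (k - j) * q₂.eval (α' j) := by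
      intro j hj
      have hz : ∏ i ∈ range (k + 1), (α' j - α' i) = 0 := prod_eq_zero (mem_range.2 hj) (sub_self _)
      have hs := sign_prod (k + 1) (k - j) γ (α' j) (by omega)
        (fun i hi => by linarith [hγle i j (by omega) hj, hα'1 j hj])
        (fun i hi hi' => by linarith [hα'2 j hj, (hJ (j + 1) (by omega)).1, hγle (j + 1) i (by omega) hi'])
      rw [hev₂, hz]; simp only [mul_zero, sub_zero]
      rw [show (-1 : ℝ) ^ (k - j) * (lq * ∏ i ∈ range (k + 1), (α' j - γ i))
        = lq * ((-1 : ℝ) ^ (k - j) * ∏ i ∈ range (k + 1), (α' j - γ i)) by ring]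
      exact mul_pos hlq hs
    have hsB2 : ∀ j, j < k + 1 → 0 < (-1 : ℝ) ^ (k - j) * q₂.eval (γ j) := by
      intro j hj
      have hz : ∏ i ∈ range (k + 1), (γ j - γ i) = 0 := prod_eq_zero (mem_range.2 hj) (sub_self _)
      have hs := sign_prod (k + 1) (k + 1 - j) α' (γ j) (by omega)
        (fun i hi => by linarith [hα'2 i (by omega), (hJ j hj).1, hαle (i + 1) j (by omega) (by omega)])
        (fun i hi hi' => by linarith [hα'le j i (by omega) hi', hα'1 j hj])
      rw [hev₂, hz, mul_zero, zero_sub]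
      rw [show (-1 : ℝ) ^ (k - j) * -(c' * (lp₁ * ∏ i ∈ range (k + 1), (γ j - α' i)))
        = (c' * lp₁) * ((-1 : ℝ) ^ (k - j) * (-1) * ∏ i ∈ range (k + 1), (γ j - α' i)) by ring,
        show (-1 : ℝ) ^ (k - j) * (-1) = (-1) ^ (k + 1 - j) by
          rw [← pow_succ, show k - j + 1 = k + 1 - j by omega]]
      exact mul_pos (mul_pos hc'pos hlp₁pos) hs
    have hexB : ∀ j, j < k → ∃ x, α' j < x ∧ x < γ (j + 1) ∧ q₂.eval x = 0 := by
      intro j hj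
      apply exists_root_of_sign_change _ q₂.continuous _ _
        (by linarith [hα'2 j (by omega), (hJ (j + 1) (by omega)).1])
      have h1 := hsB1 j (by omega)
      have h2 := hsB2 (j + 1) (by omega)
      rw [show (-1 : ℝ) ^ (k - j) = (-1) ^ (k - (j + 1)) * (-1) by
        rw [← pow_succ, show k - (j + 1) + 1 = k - j by omega]] at h1
      exact mul_neg_of_signs _ _ _ h1 h2
    choose! γ' hγ' using hexB
    have hγ'mono : ∀ i j, i < j → j < k → γ' i < γ' j := by
      intro i j hij hjk
      linarith [(hγ' i (by omega)).2.1, (hγ' j hjk).1, hα'1 j (by omega), hγle (i + 1) j (by omega) (by omega)]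
    have hxk : ∀ j, j < k → γ' j < α' k := by
      intro j hj; linarith [(hγ' j hj).2.1, hα'1 k (by omega), hγle (j + 1) k (by omega) (by omega)]
    obtain ⟨hqnd, hqlc⟩ := prodForm_natDegree lq (ne_of_gt hlq) γ (k + 1)
    rw [← hqt] at hqnd hqlc
    obtain ⟨hG₂nd, hG₂lc⟩ := prodForm_natDegree (c' * lp₁) (ne_of_gt (mul_pos hc'pos hlp₁pos)) α' (k + 1)
    have hG₂form : C c' * p₁ = C (c' * lp₁) * ∏ j ∈ range (k + 1), (X - C (α' j)) := by
      rw [hp₁form, ← mul_assoc, ← C_mul]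
    rw [← hG₂form] at hG₂nd hG₂lc
    have hq₂deg : q₂.degree ≤ (k : ℕ) := by
      rw [hq₂]; exact degree_sub_le_of_cancel qt (C c' * p₁) k hqnd hG₂nd (by rw [hqlc, hG₂lc, hc'lp])
    have hq₂form := eq_prod_of_roots k q₂ hq₂deg γ' hγ'mono (fun j hj => (hγ' j hj).2.2) (α' k) hxk
    obtain ⟨lq₂, hlq₂⟩ : ∃ lq₂ : ℝ, lq₂ = q₂.eval (α' k) / ∏ j ∈ range k, (α' k - γ' j) := ⟨_, rfl⟩
    rw [← hlq₂] at hq₂form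
    have hlq₂pos : 0 < lq₂ := by
      rw [hlq₂]
      refine div_pos ?_ (prod_pos fun j hj => by rw [mem_range] at hj; linarith [hxk j hj])
      have := hsB1 k (by omega); rwa [Nat.sub_self, pow_zero, one_mul] at this
    ------------------------------------------------------------------ recursion
    obtain ⟨P, Q, cs, cs', κ, hκ, hcs, hcs', hP0, hQ0, hrecA, hrecB, hPT, hQT⟩ :=
      ih lp₁ lq₂ α' γ' hlp₁pos hlq₂pos (by linarith [hα'2 k (by omega)])
        (fun i hi => ⟨(hγ' i hi).1, by linarith [(hγ' i hi).2.1, hα'1 (i + 1) (by omega)]⟩)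
    refine ⟨fun j => if j = 0 then p else P (j - 1), fun j => if j = 0 then qt else Q (j - 1),
      fun j => if j = 0 then c else cs (j - 1), fun j => if j = 0 then c' else cs' (j - 1), κ, hκ,
      fun j => ?_, fun j => ?_, ?_, ?_, fun j hj => ?_, fun j hj => ?_, ?_, ?_⟩
    · dsimp only; split_ifs
      · exact hcpos.le
      · exact hcs _
    · dsimp only; split_ifs
      · exact hc'pos.le
      · exact hcs' _
    · dsimp only; rw [if_pos rfl, hp]
    · dsimp only; rw [if_pos rfl, hqt]
    · dsimp only
      rcases j with _ | j
      · rw [if_pos rfl, if_neg (Nat.succ_ne_zero 0), if_pos rfl, if_pos rfl, show 0 + 1 - 1 = 0 by omega, hP0,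
          ← hp₁form, hp₁]; ring
      · rw [if_neg (Nat.succ_ne_zero j), if_neg (by omega), if_neg (Nat.succ_ne_zero j),
          if_neg (Nat.succ_ne_zero j), Nat.add_sub_cancel, show j + 1 + 1 - 1 = j + 1 by omega]
        exact hrecA j (by omega)
    · dsimp only
      rcases j with _ | j
      · rw [if_pos rfl, if_neg (Nat.succ_ne_zero 0), if_pos rfl, if_neg (Nat.succ_ne_zero 0),
          show 0 + 1 - 1 = 0 by omega, hQ0, ← hq₂form, hP0, ← hp₁form, hq₂]; ring
      · rw [if_neg (Nat.succ_ne_zero j), if_neg (by omega), if_neg (Nat.succ_ne_zero j),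
          if_neg (by omega), Nat.add_sub_cancel, show j + 1 + 1 - 1 = j + 1 by omega]
        exact hrecB j (by omega)
    · dsimp only; rw [if_neg (by omega), show k + 1 + 1 - 1 = k + 1 by omega]; exact hPT
    · dsimp only; rw [if_neg (by omega), show k + 1 + 1 - 1 = k + 1 by omega]; exact hQT


/-- **The Hurwitz matrix of a positive pair is totally nonnegative** (Asner–Kemperman).  For
`p = lp·∏_{i≤k}(X - α_i)`, `q = lq·∏_{i<k}(X - γ_i)` with `lp, lq > 0` and `α_0 < γ_0 < α_1 < … < γ_{k-1} < α_k < 0`,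
the matrix `H(2n, l) = [X^{n-l}] p`, `H(2n+1, l) = [X^{n-l}] q` (zero for `l > n`) has all its minors `≥ 0`. -/
theorem positivePair_hurwitz_tn (k : ℕ) (lp lq : ℝ) (α γ : ℕ → ℝ) (hlp : 0 < lp) (hlq : 0 < lq) (hα : α k < 0)
    (hJ : ∀ i, i < k → α i < γ i ∧ γ i < α (i + 1)) {m : ℕ} (r s : Fin m → ℕ) (hr : StrictMono r)
    (hs : StrictMono s) :
    0 ≤ (Matrix.of fun i j =>
      if r i % 2 = 0 then (if s j ≤ r i / 2 then (C lp * ∏ i ∈ range (k + 1), (X - C (α i))).coeff (r i / 2 - s j) else 0)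
      else (if s j ≤ r i / 2 then (C lq * ∏ i ∈ range k, (X - C (γ i))).coeff (r i / 2 - s j) else 0)).det := by
  obtain ⟨P, Q, cs, cs', κ, hκ, hcs, hcs', hP0, hQ0, hrecA, hrecB, hPT, hQT⟩ :=
    classicalRouthChain_exists k lp lq α γ hlp hlq hα hJ
  -- rescaled coefficient rows: X_j(n,l) = n!/l! · [X^{n-l}] P_j  (the rows of P_j(D))
  set Xk : ℕ → ℕ → ℕ → ℝ := fun j n l =>
    if l ≤ n then (n.descFactorial (n - l) : ℝ) * (P j).coeff (n - l) else 0 with hXk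
  set Yk : ℕ → ℕ → ℕ → ℝ := fun j n l =>
    if l ≤ n then (n.descFactorial (n - l) : ℝ) * (Q j).coeff (n - l) else 0 with hYk
  have hTN : 0 ≤ (Matrix.of fun i j =>
      if r i % 2 = 0 then Xk 0 (r i / 2) (s j) else Yk 0 (r i / 2) (s j)).det := by
    refine chain_tn (k + 1) Xk Yk cs cs' (fun _ => 0) κ hκ.le hcs hcs' (fun _ => le_rfl) ?_ ?_ ?_ ?_ ?_
      r s hr hs
    · -- X_j 0 = X_{j+1} 0
      intro j hj l
      simp only [hXk]
      by_cases hl : l ≤ 0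
      · have hl0 : l = 0 := by omega
        subst hl0
        rw [if_pos le_rfl, if_pos le_rfl, Nat.sub_zero, hrecA j hj, coeff_add, mul_assoc, coeff_C_mul,
          coeff_X_mul_zero, mul_zero, add_zero]
      · rw [if_neg hl, if_neg hl]
    · -- step A
      intro j hj n l
      simp only [hXk, hYk]
      rcases Nat.lt_trichotomy l (n + 1) with hl | hl | hl
      · rw [if_pos hl.le, if_pos hl.le, if_pos (by omega), show n + 1 - l = (n - l) + 1 by omega, hrecA j hj,
          coeff_add, mul_assoc (C (cs j)), coeff_C_mul, coeff_X_mul, Nat.succ_descFactorial_succ]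
        push_cast; ring
      · subst hl
        rw [if_pos le_rfl, if_pos le_rfl, if_neg (by omega), Nat.sub_self, hrecA j hj, coeff_add,
          mul_assoc (C (cs j)), coeff_C_mul, coeff_X_mul_zero]
        ring
      · rw [if_neg (by omega), if_neg (by omega), if_neg (by omega)]; ring
    · -- step B
      intro j hj n l
      simp only [hXk, hYk]
      by_cases hl : l ≤ n
      · rw [if_pos hl, if_pos hl, if_pos hl, hrecB j hj, coeff_add, coeff_C_mul]; ring
      · rw [if_neg hl, if_neg hl, if_neg hl]; ring
    · -- terminal X
      intro n l
      simp only [hXk]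
      rw [hPT]
      rcases Nat.lt_trichotomy l n with hl | hl | hl
      · rw [if_pos hl.le, if_neg (by omega), coeff_C, if_neg (by omega), mul_zero]
      · subst hl; rw [if_pos le_rfl, if_pos rfl, Nat.sub_self, coeff_C, if_pos rfl, Nat.descFactorial_zero]; simp
      · rw [if_neg (by omega), if_neg (by omega)]
    · intro n l; simp only [hYk]; rw [hQT, coeff_zero, mul_zero]; simp
  -- undo the diagonal rescaling: H = diag((r/2)!⁻¹-type) · K · diag(l!)
  have hfac : ∀ n l : ℕ, l ≤ n → (n.descFactorial (n - l) : ℝ) = (Nat.factorial n : ℝ) / (Nat.factorial l : ℝ) := by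
    intro n l hl
    rw [eq_div_iff (by positivity), ← Nat.cast_mul]
    congr 1
    have := Nat.factorial_mul_descFactorial (Nat.sub_le n l)
    rw [show n - (n - l) = l by omega] at this
    rw [mul_comm]; exact this
  have heq : (Matrix.of fun i j =>
      if r i % 2 = 0 then (if s j ≤ r i / 2 then (C lp * ∏ i ∈ range (k + 1), (X - C (α i))).coeff (r i / 2 - s j) else 0)
      else (if s j ≤ r i / 2 then (C lq * ∏ i ∈ range k, (X - C (γ i))).coeff (r i / 2 - s j) else 0)) =
      Matrix.of fun i j => ((Nat.factorial (r i / 2) : ℝ))⁻¹ *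
        (if r i % 2 = 0 then Xk 0 (r i / 2) (s j) else Yk 0 (r i / 2) (s j)) * (Nat.factorial (s j) : ℝ) := by
    ext i j
    simp only [Matrix.of_apply, hXk, hYk, ← hP0, ← hQ0]
    have hf0 : ((Nat.factorial (r i / 2) : ℕ) : ℝ) ≠ 0 := by positivity
    by_cases hpar : r i % 2 = 0
    · simp only [if_pos hpar]
      split_ifs with hl
      · rw [hfac _ _ hl]; field_simp
      · ring
    · simp only [if_neg hpar]
      split_ifs with hl
      · rw [hfac _ _ hl]; field_simp
      · ring
  rw [heq, TNKernel.det_kernel_scale (fun t l => if t % 2 = 0 then Xk 0 (t / 2) l else Yk 0 (t / 2) l)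
    (fun t => ((Nat.factorial (t / 2) : ℝ))⁻¹) (fun l => (Nat.factorial l : ℝ)) r s]
  exact mul_nonneg (prod_nonneg fun _ _ => by positivity) (mul_nonneg (prod_nonneg fun _ _ => by positivity) hTN)

end DiffHurwitz

end Summit.CriticalPhenomena.PercolationContinuityZ3.Theorems
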